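import Mathlib.MeasureTheory.Constructions.HaarToSphere
import Mathlib.MeasureTheory.Measure.Haar.InnerProductSpace
import Mathlib.Analysis.SpecialFunctions.Integrals.Basic
import Literature.MeasureTheory.Hausdorff.SphericalCap
import HarnessLib

/-!
# Volumes of right circular cones and of the solid sector over a spherical cap

Support file (all results proved) for the area of the round `2`-sphere with respect to the
Euclidean Hausdorff measure (`SphereArea.lean`). Mathlib's polar surface measure
`volume.toSphere` on the unit sphere gives a subset `A` the mass `dim E · vol ((0,1) • A)`
(`Measure.toSphere_apply'`), so its value on the cap `cap v c = {‖x‖ = 1, ⟪v, x⟫ > c}`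
(`SphericalCap.lean`) is `3 ·` the volume of the solid sector `(0,1) • cap v c`. We squeeze that
sector between two right circular cones with apex `0`, axis `v` and slope `t = √(1 - c²)/c`, of
heights `c` and `1` (`cone_subset_Ioo_smul_cap`, `Ioo_smul_cap_subset_cone`), and compute the
volume `π t² H³ / 3` of a right circular cone of height `H` by Cavalieri's principle
(`volume_cone`): in coordinates adapted to an orthonormal basis `b` with `b 2 = v`
(`coneCoord b : E → ℝ × ℝ²`, measure preserving) the cone is a product-measurable set whose slices
are discs of radius `t z` (`volume_cone_prod`, `volume_disc_fin_two`). Result: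
`π (1 - c²) c / 3 ≤ vol ((0,1) • cap (b 2) c) ≤ π (1 - c²) / (3 c²)`
(`le_volume_Ioo_smul_cap`, `volume_Ioo_smul_cap_le`).

## References

* H. Federer, *Geometric measure theory* (1969), 2.10.11, 3.2.13 (classical volumes).
-/

noncomputable section

open Set Metric Module Submodule Filter
open _root_.MeasureTheory _root_.MeasureTheory.Measure
open scoped ENNReal NNReal Topology RealInnerProductSpace Pointwise

namespace Literature.MeasureTheory.Hausdorff

/-! ### Volumes of right circular cones -/

/-- The planar set `{w : Fin 2 → ℝ | w 0 ² + w 1 ² < R ²}` has Lebesgue measure `π R²`. [folklore] -/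
theorem volume_disc_fin_two {R : ℝ} (hR : 0 ≤ R) :
    volume {w : Fin 2 → ℝ | w 0 ^ 2 + w 1 ^ 2 < R ^ 2} = ENNReal.ofReal (Real.pi * R ^ 2) := by
  have hmp := PiLp.volume_preserving_toLp (Fin 2)
  have hset : {w : Fin 2 → ℝ | w 0 ^ 2 + w 1 ^ 2 < R ^ 2} =
      (WithLp.toLp 2) ⁻¹' ball (0 : EuclideanSpace ℝ (Fin 2)) R := by
    ext w
    simp [EuclideanSpace.ball_zero_eq R hR, Fin.sum_univ_two]
  rw [hset, hmp.measure_preimage measurableSet_ball.nullMeasurableSet,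
    EuclideanSpace.volume_ball_fin_two, ← ENNReal.ofReal_pow hR, ← ENNReal.ofReal_mul (by positivity),
    mul_comm]

/-- The cone `{(z, w) | 0 < z < H, w 0 ² + w 1 ² < t² z²}` in `ℝ × ℝ²` is measurable. [folklore] -/
theorem measurableSet_cone_prod (H t : ℝ) :
    MeasurableSet {p : ℝ × (Fin 2 → ℝ) | 0 < p.1 ∧ p.1 < H ∧ p.2 0 ^ 2 + p.2 1 ^ 2 < t ^ 2 * p.1 ^ 2} := by
  have hS' : {p : ℝ × (Fin 2 → ℝ) | 0 < p.1 ∧ p.1 < H ∧ p.2 0 ^ 2 + p.2 1 ^ 2 < t ^ 2 * p.1 ^ 2} =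
      {p : ℝ × (Fin 2 → ℝ) | 0 < p.1} ∩ ({p : ℝ × (Fin 2 → ℝ) | p.1 < H} ∩
        {p : ℝ × (Fin 2 → ℝ) | p.2 0 ^ 2 + p.2 1 ^ 2 < t ^ 2 * p.1 ^ 2}) := rfl
  have h1 : Measurable fun p : ℝ × (Fin 2 → ℝ) ↦ p.2 0 ^ 2 + p.2 1 ^ 2 := by fun_prop
  have h2 : Measurable fun p : ℝ × (Fin 2 → ℝ) ↦ t ^ 2 * p.1 ^ 2 := by fun_prop
  rw [hS']
  exact (measurableSet_lt measurable_const measurable_fst).inter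
    ((measurableSet_lt measurable_fst measurable_const).inter (measurableSet_lt h1 h2))

/-- The right circular cone `{(z, w) | 0 < z < H, w 0 ² + w 1 ² < t² z²}` in `ℝ × ℝ²` has volume
`π t² H³ / 3` (Cavalieri). [folklore] -/
theorem volume_cone_prod {H t : ℝ} (hH : 0 ≤ H) (ht : 0 ≤ t) :
    volume {p : ℝ × (Fin 2 → ℝ) | 0 < p.1 ∧ p.1 < H ∧ p.2 0 ^ 2 + p.2 1 ^ 2 < t ^ 2 * p.1 ^ 2} =
      ENNReal.ofReal (Real.pi * t ^ 2 * H ^ 3 / 3) := by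
  set S := {p : ℝ × (Fin 2 → ℝ) | 0 < p.1 ∧ p.1 < H ∧ p.2 0 ^ 2 + p.2 1 ^ 2 < t ^ 2 * p.1 ^ 2}
  have hS : MeasurableSet S := measurableSet_cone_prod H t
  rw [show (volume : Measure (ℝ × (Fin 2 → ℝ))) = volume.prod volume from rfl,
    Measure.prod_apply hS]
  have hslice : ∀ z : ℝ, volume (Prod.mk z ⁻¹' S) =
      (Ioo 0 H).indicator (fun z ↦ ENNReal.ofReal (Real.pi * (t ^ 2 * z ^ 2))) z := by
    intro z
    by_cases hz : z ∈ Ioo 0 H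
    · rw [indicator_of_mem hz]
      have : Prod.mk z ⁻¹' S = {w : Fin 2 → ℝ | w 0 ^ 2 + w 1 ^ 2 < (t * z) ^ 2} := by
        ext w
        simp [S, hz.1, hz.2, mul_pow]
      rw [this, volume_disc_fin_two (mul_nonneg ht hz.1.le), mul_pow]
    · rw [indicator_of_notMem hz]
      have : Prod.mk z ⁻¹' S = ∅ := by
        ext w
        simp only [S, mem_preimage, mem_setOf_eq, mem_empty_iff_false, iff_false, not_and]
        intro h1 h2
        exact absurd ⟨h1, h2⟩ hz
      rw [this, measure_empty]
  simp_rw [hslice]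
  rw [lintegral_indicator measurableSet_Ioo]
  have hint : IntegrableOn (fun z ↦ Real.pi * (t ^ 2 * z ^ 2)) (Ioo 0 H) volume :=
    (Continuous.integrableOn_Icc (by fun_prop)).mono_set Ioo_subset_Icc_self
  rw [← ofReal_integral_eq_lintegral_ofReal hint
    (Filter.Eventually.of_forall fun z ↦ by positivity)]
  congr 1
  rw [← integral_Ioc_eq_integral_Ioo, ← intervalIntegral.integral_of_le hH,
    intervalIntegral.integral_const_mul, intervalIntegral.integral_const_mul, integral_pow]
  ring

variable {E : Type*} [NormedAddCommGroup E] [InnerProductSpace ℝ E]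

/-- The right circular cone of height `H` and slope `t` with apex `0` and axis `b 2`, for an
orthonormal basis `b`. [folklore] -/
def cone (b : OrthonormalBasis (Fin 3) ℝ E) (H t : ℝ) : Set E :=
  {x | 0 < ⟪b 2, x⟫ ∧ ⟪b 2, x⟫ < H ∧ ‖x‖ ^ 2 - ⟪b 2, x⟫ ^ 2 < t ^ 2 * ⟪b 2, x⟫ ^ 2}

/-- Adapted coordinates `x ↦ (x₂, (x₀, x₁))`. [folklore] -/
def coneCoord (b : OrthonormalBasis (Fin 3) ℝ E) : E → ℝ × (Fin 2 → ℝ) :=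
  fun x ↦ MeasurableEquiv.piFinSuccAbove (fun _ ↦ ℝ) 2 (WithLp.ofLp (b.repr x))

/-- The first adapted coordinate is the height `⟪b 2, x⟫`. [folklore] -/
theorem coneCoord_fst (b : OrthonormalBasis (Fin 3) ℝ E) (x : E) :
    (coneCoord b x).1 = ⟪b 2, x⟫ := by
  simp [coneCoord, OrthonormalBasis.repr_apply_apply]

/-- The planar adapted coordinates are `⟪b 0, x⟫`, `⟪b 1, x⟫`. [folklore] -/
theorem coneCoord_snd_zero (b : OrthonormalBasis (Fin 3) ℝ E) (x : E) :
    (coneCoord b x).2 0 = ⟪b 0, x⟫ := by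
  simp [coneCoord, Fin.removeNth, OrthonormalBasis.repr_apply_apply]

/-- The planar adapted coordinates are `⟪b 0, x⟫`, `⟪b 1, x⟫`. [folklore] -/
theorem coneCoord_snd_one (b : OrthonormalBasis (Fin 3) ℝ E) (x : E) :
    (coneCoord b x).2 1 = ⟪b 1, x⟫ := by
  simp [coneCoord, Fin.removeNth, OrthonormalBasis.repr_apply_apply]
  rfl

/-- Parseval in an orthonormal basis of a `3`-space: `‖x‖² = Σᵢ ⟪b i, x⟫²`. [folklore] -/
theorem norm_sq_eq_sum_three (b : OrthonormalBasis (Fin 3) ℝ E) (x : E) :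
    ‖x‖ ^ 2 = ⟪b 0, x⟫ ^ 2 + ⟪b 1, x⟫ ^ 2 + ⟪b 2, x⟫ ^ 2 := by
  rw [← b.repr.norm_map x, EuclideanSpace.norm_sq_eq, Fin.sum_univ_three]
  simp [OrthonormalBasis.repr_apply_apply, sq_abs]

/-- The cone in adapted coordinates. [folklore] -/
theorem cone_eq_preimage (b : OrthonormalBasis (Fin 3) ℝ E) (H t : ℝ) :
    cone b H t = coneCoord b ⁻¹'
      {p : ℝ × (Fin 2 → ℝ) | 0 < p.1 ∧ p.1 < H ∧ p.2 0 ^ 2 + p.2 1 ^ 2 < t ^ 2 * p.1 ^ 2} := by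
  ext x
  simp only [cone, mem_setOf_eq, mem_preimage, coneCoord_fst, coneCoord_snd_zero, coneCoord_snd_one,
    norm_sq_eq_sum_three b x]
  constructor
  · rintro ⟨h1, h2, h3⟩; exact ⟨h1, h2, by linarith⟩
  · rintro ⟨h1, h2, h3⟩; exact ⟨h1, h2, by linarith⟩

variable [FiniteDimensional ℝ E] [MeasurableSpace E] [BorelSpace E]

/-- The adapted coordinates are measure preserving (orthonormal change of basis, `EuclideanSpace ≃ (Fin 3 → ℝ)`, and `Fin.insertNth`-splitting, all measure preserving in Mathlib). [folklore] -/
theorem measurePreserving_coneCoord (b : OrthonormalBasis (Fin 3) ℝ E) :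
    MeasurePreserving (coneCoord b) volume volume :=
  ((volume_preserving_piFinSuccAbove (fun _ : Fin 3 ↦ ℝ) 2).comp
    (PiLp.volume_preserving_ofLp (Fin 3))).comp b.measurePreserving_repr

/-- **Volume of a right circular cone** of height `H` and slope `t`: `π t² H³ / 3`. [folklore] -/
theorem volume_cone (b : OrthonormalBasis (Fin 3) ℝ E) {H t : ℝ} (hH : 0 ≤ H) (ht : 0 ≤ t) :
    volume (cone b H t) = ENNReal.ofReal (Real.pi * t ^ 2 * H ^ 3 / 3) := by
  rw [cone_eq_preimage, (measurePreserving_coneCoord b).measure_preimage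
    (measurableSet_cone_prod H t).nullMeasurableSet, volume_cone_prod hH ht]


/-! ### Cones over spherical caps -/

omit [FiniteDimensional ℝ E] [MeasurableSpace E] [BorelSpace E] in
/-- Membership in the cone `(0, 1) • s` over a subset `s` of the unit sphere. [folklore] -/
theorem mem_Ioo_smul_iff_of_subset_sphere {s : Set E} (hs : s ⊆ sphere (0 : E) 1) {x : E} :
    x ∈ Ioo (0 : ℝ) 1 • s ↔ 0 < ‖x‖ ∧ ‖x‖ < 1 ∧ ‖x‖⁻¹ • x ∈ s := by
  constructor
  · rintro ⟨r, hr, ω, hω, rfl⟩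
    have hω1 : ‖ω‖ = 1 := mem_sphere_zero_iff_norm.1 (hs hω)
    have hn : ‖r • ω‖ = r := by rw [norm_smul, hω1, mul_one, Real.norm_of_nonneg hr.1.le]
    rw [hn]
    refine ⟨hr.1, hr.2, ?_⟩
    rwa [smul_smul, inv_mul_cancel₀ hr.1.ne', one_smul]
  · rintro ⟨h0, h1, hmem⟩
    refine ⟨‖x‖, ⟨h0, h1⟩, ‖x‖⁻¹ • x, hmem, ?_⟩
    show ‖x‖ • (‖x‖⁻¹ • x) = x
    rw [smul_smul, mul_inv_cancel₀ h0.ne', one_smul]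

omit [FiniteDimensional ℝ E] [MeasurableSpace E] [BorelSpace E] in
/-- Caps are subsets of the unit sphere. [folklore] -/
theorem cap_subset_sphere (v : E) (c : ℝ) : cap v c ⊆ sphere (0 : E) 1 :=
  fun _ hx ↦ mem_sphere_zero_iff_norm.2 hx.1

omit [FiniteDimensional ℝ E] [MeasurableSpace E] [BorelSpace E] in
/-- The cone over the cap of height `c` (`0 < c < 1`) lies in the right cone of height `1` and
slope `√(1 - c²)/c`. [folklore] -/
theorem Ioo_smul_cap_subset_cone (b : OrthonormalBasis (Fin 3) ℝ E) {c : ℝ} (hc0 : 0 < c)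
    (hc1 : c < 1) : Ioo (0 : ℝ) 1 • cap (b 2) c ⊆ cone b 1 (Real.sqrt (1 - c ^ 2) / c) := by
  intro x hx
  rw [mem_Ioo_smul_iff_of_subset_sphere (cap_subset_sphere _ _)] at hx
  obtain ⟨h0, h1, -, hc⟩ := hx
  rw [inner_smul_right, lt_inv_mul_iff₀ h0] at hc
  -- `hc : c * ‖x‖ < ⟪b 2, x⟫`
  have hz0 : 0 < ⟪b 2, x⟫ := lt_of_le_of_lt (by positivity) hc
  have hz1 : ⟪b 2, x⟫ < 1 := by
    have := real_inner_le_norm (b 2) x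
    rw [b.orthonormal.1, one_mul] at this
    linarith
  refine ⟨hz0, hz1, ?_⟩
  have ht2 : (Real.sqrt (1 - c ^ 2) / c) ^ 2 = (1 - c ^ 2) / c ^ 2 := by
    rw [div_pow, Real.sq_sqrt (by nlinarith)]
  rw [ht2]
  have hsq : c ^ 2 * ‖x‖ ^ 2 < ⟪b 2, x⟫ ^ 2 := by
    have := mul_self_lt_mul_self (by positivity) hc
    nlinarith
  have hc2 : 0 < c ^ 2 := by positivity
  rw [div_mul_eq_mul_div, lt_div_iff₀ hc2]
  nlinarith

omit [FiniteDimensional ℝ E] [MeasurableSpace E] [BorelSpace E] in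
/-- The right cone of height `c` and slope `√(1 - c²)/c` lies in the cone over the cap of height
`c` (`0 < c < 1`). [folklore] -/
theorem cone_subset_Ioo_smul_cap (b : OrthonormalBasis (Fin 3) ℝ E) {c : ℝ} (hc0 : 0 < c)
    (hc1 : c < 1) : cone b c (Real.sqrt (1 - c ^ 2) / c) ⊆ Ioo (0 : ℝ) 1 • cap (b 2) c := by
  intro x hx
  obtain ⟨hz0, hzc, hq⟩ := hx
  have ht2 : (Real.sqrt (1 - c ^ 2) / c) ^ 2 = (1 - c ^ 2) / c ^ 2 := by
    rw [div_pow, Real.sq_sqrt (by nlinarith)]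
  rw [ht2] at hq
  have hc2 : 0 < c ^ 2 := by positivity
  rw [div_mul_eq_mul_div, lt_div_iff₀ hc2] at hq
  -- `hq : (‖x‖² - z²) c² < (1 - c²) z²`, i.e. `c² ‖x‖² < z²`
  have hzx : ⟪b 2, x⟫ ≤ ‖x‖ := by
    have := real_inner_le_norm (b 2) x
    rwa [b.orthonormal.1, one_mul] at this
  have hx0 : 0 < ‖x‖ := hz0.trans_le hzx
  have hz2 : ⟪b 2, x⟫ ^ 2 < c ^ 2 := by nlinarith
  have hcx : c ^ 2 * ‖x‖ ^ 2 < c ^ 2 * 1 := by nlinarith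
  have hx1 : ‖x‖ < 1 := by
    have h' : ‖x‖ ^ 2 < 1 := lt_of_mul_lt_mul_left hcx hc2.le
    by_contra h2
    push Not at h2
    nlinarith
  rw [mem_Ioo_smul_iff_of_subset_sphere (cap_subset_sphere _ _)]
  refine ⟨hx0, hx1, ?_, ?_⟩
  · rw [norm_smul, norm_inv, norm_norm, inv_mul_cancel₀ hx0.ne']
  · rw [inner_smul_right, lt_inv_mul_iff₀ hx0]
    -- goal `c * ‖x‖ < ⟪b 2, x⟫`
    by_contra h
    push Not at h
    have := mul_self_le_mul_self hz0.le h
    nlinarith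

/-- **The cone over a cap, squeezed between right cones**: for `0 < c < 1`,
`π (1 - c²) c / 3 ≤ vol ((0,1) • cap) ≤ π (1 - c²) / (3 c²)`. [folklore] -/
theorem volume_Ioo_smul_cap_le (b : OrthonormalBasis (Fin 3) ℝ E) {c : ℝ} (hc0 : 0 < c)
    (hc1 : c < 1) :
    volume (Ioo (0 : ℝ) 1 • cap (b 2) c) ≤ ENNReal.ofReal (Real.pi * (1 - c ^ 2) / (3 * c ^ 2)) := by
  refine (measure_mono (Ioo_smul_cap_subset_cone b hc0 hc1)).trans ?_
  rw [volume_cone b zero_le_one (by positivity), div_pow, Real.sq_sqrt (by nlinarith)]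
  apply le_of_eq
  congr 1
  field_simp

/-- **The solid sector over a cap contains the right cone of height `c`**: for `0 < c < 1`,
`π (1 - c²) c / 3 ≤ vol ((0,1) • cap (b 2) c)`. [folklore] -/
theorem le_volume_Ioo_smul_cap (b : OrthonormalBasis (Fin 3) ℝ E) {c : ℝ} (hc0 : 0 < c)
    (hc1 : c < 1) :
    ENNReal.ofReal (Real.pi * (1 - c ^ 2) * c / 3) ≤ volume (Ioo (0 : ℝ) 1 • cap (b 2) c) := by
  refine le_trans ?_ (measure_mono (cone_subset_Ioo_smul_cap b hc0 hc1))
  rw [volume_cone b hc0.le (by positivity), div_pow, Real.sq_sqrt (by nlinarith)]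
  apply le_of_eq
  congr 1
  field_simp


end Literature.MeasureTheory.Hausdorff

end
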